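import Mathlib
import Summits.Ventures.PercRepro.TriangleCapDeltaForm

/-!
# PercRepro — the witness `W29` of the kill of ROW C-046 as a Mathlib matroid (p3, gen 27; part 1 of 2)

ROW C-046 (the Δ-existence form of the triangle cap, TriangleCapDeltaForm) was KILLED AS STATED on
2026-08-26 (RULING (um)(96)) by mine-4 g27's witness `W31` (two implementations) and its 29-point core
`W29`: simple binary matroids of rank `6` in the class `Core3` with MORE than `P_KK(ν)` triangles and NO
cocircuit meeting the Δ bound.  This file builds `W29` in Lean; TriangleCapW29Refutation proves
`Core3`, identifies the triangles and the cocircuits, and refutes `ExistsDeltaCocircuit (Fin 29)`.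

`W29` is the binary matroid of the `29` vectors `{2, 5, 7, 9, 10, 11, 12, 19, 20, 21, 28, 29, 30, 31,
32, 35, 37, 38, 42, 44, 45, 48, 49, 51, 54, 59, 60, 61, 62} ⊂ GF(2)^6` (`v = Σ bit_i(v)·e_i`), on the
ground set `Fin 29`, from Mathlib's `IndepMatroid.ofFinite` with `LinearIndepOn (ZMod 2) v`:

* the data: `code` (the integers), `vec` (bit decoding), `v`, `par` (bit parity), `xsum` (xor of a
  finset = the code of its vector sum), `spanCodes` / `cl` (the points in the span of a finset), `cut`
  (the points killed by two functionals), `tri` (the `3`-sets of zero xor), `coc` (the support of a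
  functional), `gainN`, `dot`, `wt` (the weight vector of a functional);
* the finite certificates, all `decide +kernel` over `ℕ` bit operations: `tri_card` (`60` triangles),
  `cert` (every nonzero functional's support has gain above `P 23 − P (23 − (|K| − 1))`), `c1cert`,
  `c2cert` (the span of `2` / `3` points holds `≤ 3` / `≤ 6` points), `c3cert` (the common kernel of two
  independent functionals holds `≤ 10` points), and the small facts (`v_ne_zero`, `v_inj`, `exists_vec_eq`,
  `dot_vec_eq_zero_iff`, `unit_eq`, …);
* the bridge `vec_xsum` (`vec (xsum t) = Σ_{i ∈ t} v i`), the augmentation axiom `aug` (linear algebra: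
  `finrank_span_image`), the matroid `M`, `indep_iff`, `span_image_eq_of_isBasis'` and the rank bridge
  **`eRk_eq : M.eRk X = finrank (span (v '' X))`**; the functional lemmas `apply_eq_dot`, `wt_injective`.

Axioms: standard.
-/

open scoped Matroid

namespace PercRepro

namespace TriangleCap

namespace W29

open Set Matroid Module Submodule

/-- `GF(2)^6`. -/
abbrev V := Fin 6 → ZMod 2

/-- The `29` points of `W29` as integers `Σ bit_i · 2^i` (mine-4 g27 / engine g68, INBOX 11483 / 11490). -/
def code : Fin 29 → ℕ :=
  ![2, 5, 7, 9, 10, 11, 12, 19, 20, 21, 28, 29, 30, 31, 32, 35, 37, 38, 42, 44, 45, 48, 49, 51, 54,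
    59, 60, 61, 62]

/-- Bit decoding `ℕ → GF(2)^6`. -/
def vec (n : ℕ) : V := fun i => if n.testBit i.val then 1 else 0

/-- The point `i` of `W29` as a vector. -/
def v (i : Fin 29) : V := vec (code i)

/-- Parity of the number of one bits of an integer below `64`. -/
def par (y : ℕ) : ℕ :=
  (y ^^^ (y >>> 1) ^^^ (y >>> 2) ^^^ (y >>> 3) ^^^ (y >>> 4) ^^^ (y >>> 5)) &&& 1

/-- The xor of the codes of a finset (the code of the sum of its vectors). -/
def xsum (t : Finset (Fin 29)) : ℕ :=
  @Finset.fold (Fin 29) ℕ (· ^^^ ·) ⟨Nat.xor_comm⟩ ⟨Nat.xor_assoc⟩ 0 code t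

/-- The codes of the span of `I`: the xors over subsets of `I`. -/
def spanCodes (I : Finset (Fin 29)) : Finset ℕ := I.powerset.image xsum

/-- The points of `W29` in the span of `I`. -/
def cl (I : Finset (Fin 29)) : Finset (Fin 29) := Finset.univ.filter (fun x => code x ∈ spanCodes I)

/-- The points on which the two functionals `n`, `m` vanish. -/
def cut (n m : ℕ) : Finset (Fin 29) :=
  Finset.univ.filter (fun x => par (n &&& code x) = 0 ∧ par (m &&& code x) = 0)

/-- The triangles: `3`-subsets with zero xor. -/
def tri : Finset (Finset (Fin 29)) := (Finset.univ.powersetCard 3).filter (fun t => xsum t = 0)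

/-- The support of the functional `n`: the candidate cocircuit. -/
def coc (n : ℕ) : Finset (Fin 29) := Finset.univ.filter (fun i => par (n &&& code i) = 1)

/-- The number of triangles meeting `coc n`. -/
def gainN (n : ℕ) : ℕ := (tri.filter (fun t => ∃ i ∈ t, i ∈ coc n)).card

/-- The dot product on `GF(2)^6`. -/
def dot (a b : V) : ZMod 2 := ∑ i, a i * b i

/-- The weight vector of a linear functional. -/
def wt (f : Module.Dual (ZMod 2) V) : V := fun i => f (fun j => if i = j then 1 else 0)

/-! ### The finite certificates (`decide +kernel`) -/

/-- `W29` has `60` triangles. -/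
theorem tri_card : tri.card = 60 := by decide +kernel

/-- Every nonzero functional's support has gain above the Δ bound at nullity `23`. -/
theorem cert : ∀ n : Fin 64, n.val ≠ 0 →
    KK.P 23 - KK.P (23 - ((coc n.val).card - 1)) < gainN n.val := by
  decide +kernel

set_option maxHeartbeats 0 in
/-- (C1): the span of two points holds at most `3` points. -/
theorem c1cert :
    ((Finset.univ.powersetCard 2).filter (fun I : Finset (Fin 29) => 3 < (cl I).card)).card = 0 := by
  decide +kernel

set_option maxHeartbeats 0 in
/-- (C2): the span of three points holds at most `6` points (no Fano plane). -/
theorem c2cert :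
    ((Finset.univ.powersetCard 3).filter (fun I : Finset (Fin 29) => 6 < (cl I).card)).card = 0 := by
  decide +kernel

set_option maxHeartbeats 0 in
/-- (C3): the common kernel of two independent functionals holds at most `10` points. -/
theorem c3cert : ∀ n m : Fin 64, n.val ≠ 0 → m.val ≠ 0 → n ≠ m → (cut n.val m.val).card ≤ 10 := by
  decide +kernel

/-! ### Small decided facts about the vectors -/

/-- The codes are below `64`. -/
theorem code_lt : ∀ i : Fin 29, code i < 64 := by decide +kernel

/-- No point is the zero vector. -/
theorem v_ne_zero : ∀ i : Fin 29, v i ≠ 0 := by decide +kernel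

/-- The points are distinct. -/
theorem v_inj : ∀ i j : Fin 29, v i = v j → i = j := by decide +kernel

/-- Bit decoding is injective below `64`. -/
theorem vec_inj_fin : ∀ a b : Fin 64, vec a = vec b → a = b := by decide +kernel

/-- Every vector of `GF(2)^6` is the decoding of an integer below `64`. -/
theorem exists_vec_eq : ∀ w : V, ∃ n : Fin 64, vec n = w := by decide +kernel

/-- The dot product with a decoded functional vanishes iff the bit parity is even. -/
theorem dot_vec_eq_zero_iff : ∀ (n : Fin 64) (x : Fin 29),
    dot (vec n) (v x) = 0 ↔ par (n.val &&& code x) = 0 := by decide +kernel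

/-- The dot product with a decoded functional is nonzero iff the bit parity is odd. -/
theorem dot_vec_ne_zero_iff : ∀ (n : Fin 64) (x : Fin 29),
    dot (vec n) (v x) ≠ 0 ↔ par (n.val &&& code x) = 1 := by decide +kernel

/-- Witnesses: the unit vector `e_i` is the sum of the points `wit i`. -/
def wit : Fin 6 → Finset (Fin 29) := ![{4, 5}, {0}, {0, 4, 6}, {0, 4}, {1, 9}, {14}]

/-- The six unit vectors are sums of points. -/
theorem unit_eq : ∀ i : Fin 6,
    (fun j => if i = j then (1 : ZMod 2) else 0) = vec (xsum (wit i)) := by decide +kernel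

/-- `{0, 1, 2}` is a triangle. -/
theorem tri_nonempty : ({0, 1, 2} : Finset (Fin 29)) ∈ tri := by decide +kernel

/-! ### The vectors -/

/-- The point map `v` is injective. -/
theorem v_injective : Function.Injective v := fun i j h => v_inj i j h

/-- `vec 0 = 0`. -/
theorem vec_zero : vec 0 = 0 := by
  funext i
  simp [vec]

/-- Bit decoding turns xor into vector addition. -/
theorem vec_xor (a b : ℕ) : vec (a ^^^ b) = vec a + vec b := by
  funext i
  simp only [vec, Nat.testBit_xor, Pi.add_apply]
  cases a.testBit i.val <;> cases b.testBit i.val <;> decide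

/-- Bit decoding is injective on the integers below `64`. -/
theorem vec_inj_of_lt {a b : ℕ} (ha : a < 64) (hb : b < 64) (h : vec a = vec b) : a = b := by
  have := vec_inj_fin ⟨a, ha⟩ ⟨b, hb⟩ h
  exact congrArg Fin.val this

/-- Every element of `ZMod 2` is `0` or `1`. -/
theorem zmod2_cases (c : ZMod 2) : c = 0 ∨ c = 1 := by
  revert c; decide

/-- `x + x = 0` in `GF(2)^6`. -/
theorem add_self_eq_zero (x : V) : x + x = 0 := by
  funext i
  have : ∀ a : ZMod 2, a + a = 0 := by decide
  exact this (x i)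

/-- The bridge: the decoding of the xor of a finset is the sum of its vectors. -/
theorem vec_xsum (t : Finset (Fin 29)) : vec (xsum t) = ∑ i ∈ t, v i := by
  induction t using Finset.induction_on with
  | empty => simp [xsum, vec_zero]
  | insert a s has ih =>
    rw [Finset.sum_insert has, ← ih]
    unfold xsum
    rw [Finset.fold_insert has]
    exact vec_xor _ _

/-- The xor of codes stays below `64`. -/
theorem xsum_lt (t : Finset (Fin 29)) : xsum t < 64 := by
  induction t using Finset.induction_on with
  | empty => simp [xsum]
  | insert a s has ih =>
    unfold xsum
    rw [Finset.fold_insert has]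
    exact Nat.xor_lt_two_pow (n := 6) (code_lt a) ih

/-! ### The matroid -/

/-- The span of an independent family of points has dimension its size. -/
theorem finrank_span_image (I : Set (Fin 29)) (hI : LinearIndepOn (ZMod 2) v I) :
    finrank (ZMod 2) (span (ZMod 2) (v '' I)) = I.ncard := by
  haveI : Fintype ↑(v '' I) := Fintype.ofFinite _
  rw [finrank_span_set_eq_card hI.id_image, ← ncard_eq_toFinset_card',
    ncard_image_of_injective _ v_injective]

/-- The augmentation axiom for linear independence (by dimension comparison of spans). -/
theorem aug {I J : Set (Fin 29)} (hI : LinearIndepOn (ZMod 2) v I) (hJ : LinearIndepOn (ZMod 2) v J)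
    (hlt : I.ncard < J.ncard) : ∃ e ∈ J, e ∉ I ∧ LinearIndepOn (ZMod 2) v (insert e I) := by
  by_contra h
  push Not at h
  have hsub : v '' J ⊆ span (ZMod 2) (v '' I) := by
    rintro _ ⟨e, heJ, rfl⟩
    by_cases heI : e ∈ I
    · exact subset_span (mem_image_of_mem v heI)
    · have hne := h e heJ heI
      rw [linearIndepOn_insert heI] at hne
      by_contra hns
      exact hne ⟨hI, hns⟩
  have hle : span (ZMod 2) (v '' J) ≤ span (ZMod 2) (v '' I) := span_le.2 hsub
  have := Submodule.finrank_mono hle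
  rw [finrank_span_image I hI, finrank_span_image J hJ] at this
  omega

/-- The matroid `W29` on `Fin 29`: a set is independent iff its vectors are linearly independent. -/
def M : Matroid (Fin 29) :=
  (IndepMatroid.ofFinite (E := (univ : Set (Fin 29))) finite_univ
    (fun I => LinearIndepOn (ZMod 2) v I)
    (linearIndepOn_empty (ZMod 2) v)
    (fun _ _ hJ hIJ => hJ.mono hIJ)
    (fun _ _ hI hJ hlt => aug hI hJ hlt)
    (fun I _ => subset_univ I)).matroid

/-- Independence in `M` is linear independence of the vectors. -/
theorem indep_iff {I : Set (Fin 29)} : M.Indep I ↔ LinearIndepOn (ZMod 2) v I := by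
  simp [M]

/-- The ground set of `M` is `univ`. -/
theorem ground_eq : M.E = univ := rfl

/-- `M` is a finite matroid. -/
theorem M_finite : M.Finite := ⟨finite_univ⟩

/-- A basis of `X` spans the same subspace as `X`. -/
theorem span_image_eq_of_isBasis' {I X : Set (Fin 29)} (hI : M.IsBasis' I X) :
    span (ZMod 2) (v '' X) = span (ZMod 2) (v '' I) := by
  refine le_antisymm (span_le.2 ?_) (span_mono (image_mono hI.subset))
  rintro _ ⟨x, hxX, rfl⟩
  by_cases hxI : x ∈ I
  · exact subset_span (mem_image_of_mem v hxI)
  · have hni := hI.insert_not_indep ⟨hxX, hxI⟩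
    rw [indep_iff, linearIndepOn_insert hxI] at hni
    by_contra hne
    exact hni ⟨indep_iff.1 hI.indep, hne⟩

/-- The rank of `X` is the dimension of the span of its vectors. -/
theorem eRk_eq (X : Set (Fin 29)) :
    M.eRk X = (finrank (ZMod 2) (span (ZMod 2) (v '' X)) : ℕ∞) := by
  obtain ⟨I, hI⟩ := M.exists_isBasis' X
  rw [hI.eRk_eq_encard, span_image_eq_of_isBasis' hI, finrank_span_image I (indep_iff.1 hI.indep),
    (toFinite I).cast_ncard_eq]


/-! ### Linear functionals and their weight vectors -/

/-- A linear functional is the dot product with its weight vector. -/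
theorem apply_eq_dot (f : Module.Dual (ZMod 2) V) (x : V) : f x = dot (wt f) x := by
  rw [LinearMap.pi_apply_eq_sum_univ f x, dot]
  refine Finset.sum_congr rfl (fun i _ => ?_)
  simp [wt, smul_eq_mul, mul_comm]

/-- A functional with zero weight vector is zero. -/
theorem eq_zero_of_wt_eq_zero {f : Module.Dual (ZMod 2) V} (h : wt f = 0) : f = 0 := by
  apply LinearMap.ext
  intro x
  rw [apply_eq_dot, h]
  simp [dot]

/-- Weight vectors determine functionals. -/
theorem wt_injective {f g : Module.Dual (ZMod 2) V} (h : wt f = wt g) : f = g := by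
  apply LinearMap.ext
  intro x
  rw [apply_eq_dot, apply_eq_dot, h]

/-- The decoding of `n : Fin 64` is a nonzero vector only if `n ≠ 0`. -/
theorem fin64_ne_zero_of_vec {n : Fin 64} {w : V} (hn : vec n = w) (hw : w ≠ 0) : n.val ≠ 0 := by
  intro h0
  apply hw
  rw [← hn]
  have : n = 0 := Fin.ext h0
  rw [this]
  exact vec_zero


end W29

end TriangleCap

end PercRepro
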